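import Summits.ValiantsHypothesis.ValiantsHypothesis.Theorems.LacunarySymmetroidMatrixDescartesCensusSharpRows

/-!
# `MatrixDescartes` census — W4 boundary layer: the circuit row in FULLY EXPANDED LOG FORM (for log-table leaves)

HONEST FRAMING.  Object-search cell `pub-symmetroid`, item `DoorA26 = PosRootLawAt 2 6 19` (stmt-ValiantsHypothesis-19979, OPEN, typed,
never asserted).  Companion of `…CensusSharpRows`: the same circuit row of a triple `r < s < u` of a sharp fewnomial
(`circuit_row_of_sharp`, table variant), but with every constant kept as the logarithm of a SMALL natural number — `log(p+q)`,
`log p`, `log q` and the three twist multipliers `log M_t` — instead of the folded numerals `L, R` of `circuit_row_log_of_table`.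
With engine-1 g25's certified log table (`…CensusLogPrimesTable`: `LogPrimes.log_nat_eq_of_factored` + the 22 enclosures `log_p`) a
generated kill file then closes each Farkas leaf by `linarith` over ≤ 22 atoms `log p`, never exponentiating a big numeral (desk R1940
recipe).  A tool; nothing here kills a cell, bounds `ζ_sym(2,6)`, decides `DoorA26`, or bears on `MatrixDescartes`
(stmt-ValiantsHypothesis-18050) / `VP ≠ VNP`.

[folklore] Weighted AM–GM (circuit number) + Rolle/Descartes with multiplicity; no single source.
-/

-- `Summit.ValiantsHypothesis.ValiantsHypothesis.…` repeats a component by the D-0017 layout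
-- (single-conjunct summit), which the `dupNamespace` linter flags; the name is mandated.
set_option linter.dupNamespace false

namespace Summit.ValiantsHypothesis.ValiantsHypothesis.Theorems.LacunarySymmetroidMatrixDescartes.Census

open Polynomial Finset
open scoped BigOperators Polynomial

/-- **CIRCUIT ROW, FULLY EXPANDED LOG FORM, TABLE VERSION** (for kill files that close their leaves with the certified log table
`…CensusLogPrimesTable` instead of one big numeral): as `circuit_row_log_of_table` but without folding the constants into `L, R`:
`(p+q)·log(p+q) + q·(log|c_r| + log M_r) + p·(log|c_u| + log M_u) ≤ (p+q)·(log|c_s| + log M_s) + q·log q + p·log p`, every numeral a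
small natural (≤ the exponent spread) whose logarithm the table expands over primes. [folklore] -/
theorem circuit_row_logs_of_table {n : ℕ} {e : ℕ → ℕ} {c : ℕ → ℝ} (he : ∀ i j, i < j → j < n → e i < e j)
    (hZ : n ≤ (∑ t ∈ range n, C (c t) * X ^ (e t) : ℝ[X]).roots.countP (fun x => 0 < x) + 1)
    (E : List ℕ) (hE : ∀ t, t < n → e t = E.getD t 0)
    {r s u : ℕ} (hrs : r < s) (hsu : s < u) (hun : u < n) (p q : ℕ) (hp : E.getD r 0 + p = E.getD s 0)
    (hq : E.getD s 0 + q = E.getD u 0) (Mr Ms Mu : ℝ)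
    (hMr : |∏ v ∈ (range n).filter (fun v => ¬(v = r ∨ v = s ∨ v = u)), (((E.getD r 0 : ℕ) : ℝ) - (E.getD v 0 : ℕ))| = Mr)
    (hMs : |∏ v ∈ (range n).filter (fun v => ¬(v = r ∨ v = s ∨ v = u)), (((E.getD s 0 : ℕ) : ℝ) - (E.getD v 0 : ℕ))| = Ms)
    (hMu : |∏ v ∈ (range n).filter (fun v => ¬(v = r ∨ v = s ∨ v = u)), (((E.getD u 0 : ℕ) : ℝ) - (E.getD v 0 : ℕ))| = Mu) :
    (p + q) * Real.log ((p + q : ℕ) : ℝ) + q * (Real.log |c r| + Real.log Mr) + p * (Real.log |c u| + Real.log Mu)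
      ≤ (p + q) * (Real.log |c s| + Real.log Ms) + q * Real.log (q : ℝ) + p * Real.log (p : ℝ) := by
  have hn : 2 ≤ n := by omega
  have hprod : ∀ t, t < n → (∏ v ∈ (range n).filter (fun v => ¬(v = r ∨ v = s ∨ v = u)), ((e t : ℝ) - e v))
      = ∏ v ∈ (range n).filter (fun v => ¬(v = r ∨ v = s ∨ v = u)), (((E.getD t 0 : ℕ) : ℝ) - (E.getD v 0 : ℕ)) := by
    intro t ht
    refine Finset.prod_congr rfl fun v hv => ?_
    have hv' : v < n := mem_range.mp (mem_filter.mp hv).1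
    rw [hE t ht, hE v hv']
  have hMr' : |∏ v ∈ (range n).filter (fun v => ¬(v = r ∨ v = s ∨ v = u)), ((e r : ℝ) - e v)| = Mr := by
    rw [hprod r (by omega)]; exact hMr
  have hMs' : |∏ v ∈ (range n).filter (fun v => ¬(v = r ∨ v = s ∨ v = u)), ((e s : ℝ) - e v)| = Ms := by
    rw [hprod s (by omega)]; exact hMs
  have hMu' : |∏ v ∈ (range n).filter (fun v => ¬(v = r ∨ v = s ∨ v = u)), ((e u : ℝ) - e v)| = Mu := by
    rw [hprod u hun]; exact hMu
  have hp' : e r + p = e s := by rw [hE r (by omega), hE s (by omega)]; exact hp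
  have hq' : e s + q = e u := by rw [hE s (by omega), hE u hun]; exact hq
  have row := circuit_row_of_sharp he hZ hrs hsu hun p q hp' hq' Mr Ms Mu hMr' hMs' hMu'
  have hp0 : 0 < p := by have := he r s hrs (by omega); omega
  have hq0 : 0 < q := by have := he s u hsu hun; omega
  have hMr0 : 0 < Mr := by rw [← hMr']; exact abs_pos.mpr (prod_sub_ne_zero_of_lt he (Or.inl rfl) (by omega))
  have hMs0 : 0 < Ms := by rw [← hMs']; exact abs_pos.mpr (prod_sub_ne_zero_of_lt he (Or.inr (Or.inl rfl)) (by omega))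
  have hMu0 : 0 < Mu := by rw [← hMu']; exact abs_pos.mpr (prod_sub_ne_zero_of_lt he (Or.inr (Or.inr rfl)) hun)
  have hcr : 0 < |c r| := abs_pos.mpr (coeff_ne_zero_of_sharp he hn hZ (by omega))
  have hcs : 0 < |c s| := abs_pos.mpr (coeff_ne_zero_of_sharp he hn hZ (by omega))
  have hcu : 0 < |c u| := abs_pos.mpr (coeff_ne_zero_of_sharp he hn hZ hun)
  have hpq0 : (0 : ℝ) < ((p + q : ℕ) : ℝ) := by positivity
  have hlog := Real.log_le_log (by positivity) row
  rw [Real.log_mul (by positivity) (by positivity), Real.log_mul (by positivity) (by positivity), Real.log_pow,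
    Real.log_pow, Real.log_pow, Real.log_mul hcr.ne' hMr0.ne', Real.log_mul hcu.ne' hMu0.ne',
    Real.log_mul (by positivity) (by positivity), Real.log_pow, Real.log_mul hcs.ne' hMs0.ne',
    Real.log_mul (by positivity) (by positivity), Real.log_pow, Real.log_pow] at hlog
  push_cast at hlog ⊢
  linarith

/-! ### Three-part collision rows (edges with a 3-monomial position, e.g. `d₃+d₄` on `3..19`) -/

/-- Dominant part against two opposite-sign parts: `x·y < 0`, `x·z < 0`, `x·(x+y+z) > 0 ⇒ |x + y + z| ≤ |x|`. [folklore] -/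
theorem abs_add_add_le_abs_of_mul_neg {x y z : ℝ} (hy : x * y < 0) (hz : x * z < 0) (hd : 0 < x * (x + y + z)) :
    |x + y + z| ≤ |x| := by
  rcases lt_or_gt_of_ne (show x ≠ 0 by rintro rfl; simp at hy) with hx | hx
  · have h1 : 0 < y := by nlinarith
    have h2 : 0 < z := by nlinarith
    have h3 : x + y + z < 0 := by nlinarith
    rw [abs_of_neg hx, abs_of_neg h3]; linarith
  · have h1 : y < 0 := by nlinarith
    have h2 : z < 0 := by nlinarith
    have h3 : 0 < x + y + z := by nlinarith
    rw [abs_of_pos hx, abs_of_pos h3]; linarith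

/-- Dominant part against two opposite-sign parts: each minor part is bounded by the dominant one. [folklore] -/
theorem abs_le_abs_of_mul_neg_three {x y z : ℝ} (hy : x * y < 0) (hz : x * z < 0) (hd : 0 < x * (x + y + z)) :
    |y| ≤ |x| ∧ |z| ≤ |x| := by
  rcases lt_or_gt_of_ne (show x ≠ 0 by rintro rfl; simp at hy) with hx | hx
  · have h1 : 0 < y := by nlinarith
    have h2 : 0 < z := by nlinarith
    have h3 : x + y + z < 0 := by nlinarith
    rw [abs_of_neg hx, abs_of_pos h1, abs_of_pos h2]; constructor <;> linarith
  · have h1 : y < 0 := by nlinarith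
    have h2 : z < 0 := by nlinarith
    have h3 : 0 < x + y + z := by nlinarith
    rw [abs_of_pos hx, abs_of_neg h1, abs_of_neg h2]; constructor <;> linarith

/-- Three same-sign parts add in absolute value. [folklore] -/
theorem abs_add_add_eq_of_mul_pos {x y z : ℝ} (hy : 0 < x * y) (hz : 0 < x * z) :
    |x + y + z| = |x| + |y| + |z| := by
  rcases lt_or_gt_of_ne (show x ≠ 0 by rintro rfl; simp at hy) with hx | hx
  · have h1 : y < 0 := by nlinarith
    have h2 : z < 0 := by nlinarith
    rw [abs_of_neg hx, abs_of_neg h1, abs_of_neg h2, abs_of_neg (by linarith)]; ring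
  · have h1 : 0 < y := by nlinarith
    have h2 : 0 < z := by nlinarith
    rw [abs_of_pos hx, abs_of_pos h1, abs_of_pos h2, abs_of_pos (by linarith)]

end Summit.ValiantsHypothesis.ValiantsHypothesis.Theorems.LacunarySymmetroidMatrixDescartes.Census
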